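import Mathlib.LinearAlgebra.Projectivization.Cardinality
import Mathlib.LinearAlgebra.Matrix.Notation
import Mathlib.Data.Matrix.Mul
import Mathlib.LinearAlgebra.Matrix.NonsingularInverse
import Mathlib.Data.Set.Card
import Mathlib.SetTheory.Cardinal.NatCard
import Mathlib.Tactic.LinearCombination
import Mathlib.Tactic.FieldSimp
import HarnessLib

/-!
# Isotropic lines of a hermitian plane over a finite field, and the lines among them stable under a scalar or a transvection

Topic `LinearAlgebra`; namespace `Literature.LinearAlgebra.HermitianPlane`.  THEOREMS ONLY (no definition, no instance, no notation, no named fact, no `sorry`).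
Cell `pub/hodgecm-mathlib`, (R2) Euler–Poincaré road (Kottwitz's function on the tree of `U(1,1)`), brick (R2-t2)(b) layer (E-α) (B-p08 (g27)): the RESIDUAL count at a
vertex of the Bruhat–Tits tree — the edges at a hyperspecial vertex `Λ` are the isotropic lines of the residual hermitian plane `Λ∕ϖΛ` over `𝓀 = 𝔽_{q²}`, and the
edges fixed by an element `γ` of the stabiliser are the lines stable under its reduction `γ̄`.

Setting: a field `𝓀` with a ring endomorphism `σ` (`σ² = 1` where needed), the antidiagonal hermitian form `⟨v, w⟩ = σ(v₀)·b·w₁ + σ(v₁)·σ(b)·w₀` (`b ≠ 0`) on `𝓀²`, lines = points of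
`ℙ 𝓀 (Fin 2 → 𝓀)`.  A line `[x : y]` is ISOTROPIC iff `x = 0` or (`x = 1` and) `σ(b y) = −b y`; so
* `ncard_isotropicLines_eq` — `#{isotropic lines} = #{z ∈ 𝓀 | σ z = −z} + 1` (`= q + 1` when `|𝓀| = q²`, `σ` the Frobenius of order two: the `q + 1` points of the Hermitian unital
  on the projective line);
* `ncard_isotropicLines_stable_smul_one_eq` — a scalar `γ̄ = c·1` fixes every line;
* `ncard_isotropicLines_stable_transvection_eq_one` — `γ̄ = c·1 + n` with `n ≠ 0`, `n² = 0` fixes exactly ONE line, `ker n`; if it is isotropic the count of stable isotropic lines is `1`.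
[cite: Flicker1998UnitaryFL, §6 p. 97] [cite: Rogawski1990, §12.6 p. 174]
-/

noncomputable section

open scoped Matrix LinearAlgebra.Projectivization
open Matrix Projectivization

namespace Literature.LinearAlgebra.HermitianPlane

variable {𝓀 : Type*} [Field 𝓀] (σ : 𝓀 →+* 𝓀)

/-! ## §1 The isotropic lines `[0 : 1]` and `[1 : y]`, `σ(b y) = −b y` -/

/-- Homogeneity: `⟨a v, a v⟩ = σ(a)·a·⟨v, v⟩`, so isotropy is a property of the line. [cite: Rogawski1990, §12.6 p. 174] -/
theorem form_smul_smul (b : 𝓀) (a : 𝓀) (v : Fin 2 → 𝓀) :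
    σ ((a • v) 0) * b * (a • v) 1 + σ ((a • v) 1) * σ b * (a • v) 0 = σ a * a * (σ (v 0) * b * v 1 + σ (v 1) * σ b * v 0) := by
  simp only [Pi.smul_apply, smul_eq_mul, map_mul]; ring

/-- The line `[1 : y]` is isotropic iff `σ(b y) = −(b y)`. [cite: Flicker1998UnitaryFL, §6 p. 97] -/
theorem form_one_cons_eq_zero_iff (b y : 𝓀) :
    σ ((![1, y] : Fin 2 → 𝓀) 0) * b * (![1, y] : Fin 2 → 𝓀) 1 + σ ((![1, y] : Fin 2 → 𝓀) 1) * σ b * (![1, y] : Fin 2 → 𝓀) 0 = 0 ↔ σ (b * y) = -(b * y) := by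
  simp only [cons_val_zero, cons_val_one, map_one, one_mul, mul_one, map_mul]
  rw [← eq_neg_iff_add_eq_zero, mul_comm (σ y) (σ b)]
  exact ⟨fun h => by rw [h, neg_neg], fun h => by rw [h, neg_neg]⟩

/-- **THE ISOTROPIC LINES OF THE HERMITIAN PLANE**: `#{ℓ ∈ ℙ(𝓀²) | ⟨ℓ, ℓ⟩ = 0} = #{z | σ z = −z} + 1` for the form `!![0, b; σb, 0]`, `b ≠ 0` — the lines `[0:1]` and `[1 : b⁻¹z]`,
`σz = −z` (`= q + 1` over `𝔽_{q²}`). [cite: Flicker1998UnitaryFL, §6 p. 97] [cite: Rogawski1990, §12.6 p. 174] -/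
theorem ncard_isotropicLines_eq [Finite 𝓀] {b : 𝓀} (hb : b ≠ 0) :
    {p : ℙ 𝓀 (Fin 2 → 𝓀) | ∃ (v : Fin 2 → 𝓀) (hv : v ≠ 0), Projectivization.mk 𝓀 v hv = p ∧
        σ (v 0) * b * v 1 + σ (v 1) * σ b * v 0 = 0}.ncard = Nat.card {z : 𝓀 // σ z = -z} + 1 := by
  classical
  have h01 : (![0, 1] : Fin 2 → 𝓀) ≠ 0 := fun h => by simpa using congrFun h 1
  have h1y : ∀ y : 𝓀, (![1, y] : Fin 2 → 𝓀) ≠ 0 := fun y h => by simpa using congrFun h 0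
  -- the parametrisation `Option {z | σz = −z} → lines`
  set f : Option {z : 𝓀 // σ z = -z} → ℙ 𝓀 (Fin 2 → 𝓀) := fun o =>
    match o with
    | none => Projectivization.mk 𝓀 ![0, 1] h01
    | some z => Projectivization.mk 𝓀 ![1, b⁻¹ * z.1] (h1y _) with hf
  have hinj : Function.Injective f := by
    rintro (_ | z) (_ | z') h
    · rfl
    · exfalso
      obtain ⟨a, ha⟩ := (mk_eq_mk_iff' 𝓀 _ _ h01 (h1y _)).1 h
      have h0 : a = 0 := by simpa using congrFun ha 0
      have h1 := congrFun ha 1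
      simp [h0] at h1
    · exfalso
      obtain ⟨a, ha⟩ := (mk_eq_mk_iff' 𝓀 _ _ (h1y _) h01).1 h
      have := congrFun ha 0; simp at this
    · obtain ⟨a, ha⟩ := (mk_eq_mk_iff' 𝓀 _ _ (h1y _) (h1y _)).1 h
      have h0 : a = 1 := by simpa using congrFun ha 0
      have h1 : a * (b⁻¹ * z'.1) = b⁻¹ * z.1 := by simpa using congrFun ha 1
      rw [h0, one_mul] at h1
      rw [Subtype.ext (mul_left_cancel₀ (inv_ne_zero hb) h1).symm]
  have hrange : Set.range f = {p : ℙ 𝓀 (Fin 2 → 𝓀) | ∃ (v : Fin 2 → 𝓀) (hv : v ≠ 0), Projectivization.mk 𝓀 v hv = p ∧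
      σ (v 0) * b * v 1 + σ (v 1) * σ b * v 0 = 0} := by
    ext p
    simp only [Set.mem_range, Set.mem_setOf_eq]
    constructor
    · rintro ⟨(_ | z), rfl⟩
      · exact ⟨![0, 1], h01, rfl, by simp⟩
      · refine ⟨![1, b⁻¹ * z.1], h1y _, rfl, ?_⟩
        rw [form_one_cons_eq_zero_iff, mul_inv_cancel_left₀ hb]
        exact z.2
    · rintro ⟨v, hv, rfl, hiso⟩
      by_cases hv0 : v 0 = 0
      · have hv1 : v 1 ≠ 0 := fun h => hv (by ext i; fin_cases i <;> simp [hv0, h])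
        refine ⟨none, ?_⟩
        show Projectivization.mk 𝓀 ![0, 1] h01 = Projectivization.mk 𝓀 v hv
        rw [mk_eq_mk_iff']
        exact ⟨(v 1)⁻¹, by ext i; fin_cases i <;> simp [hv0, hv1]⟩
      · have hz : σ (b * ((v 0)⁻¹ * v 1)) = -(b * ((v 0)⁻¹ * v 1)) := by
          have h := form_smul_smul σ b (v 0)⁻¹ v
          rw [hiso, mul_zero] at h
          have hv' : (v 0)⁻¹ • v = ![1, (v 0)⁻¹ * v 1] := by
            ext i; fin_cases i <;> simp [hv0]
          rw [hv'] at h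
          exact (form_one_cons_eq_zero_iff σ b _).1 h
        refine ⟨some ⟨b * ((v 0)⁻¹ * v 1), hz⟩, ?_⟩
        show Projectivization.mk 𝓀 ![1, b⁻¹ * (b * ((v 0)⁻¹ * v 1))] (h1y _) = Projectivization.mk 𝓀 v hv
        rw [inv_mul_cancel_left₀ hb, mk_eq_mk_iff']
        exact ⟨(v 0)⁻¹, by ext i; fin_cases i <;> simp [hv0]⟩
  rw [← hrange, Set.ncard_range_of_injective hinj, Finite.card_option]

/-! ## §2 Lines stable under `γ̄` -/

/-- **A SCALAR FIXES EVERY LINE**: for `γ̄ = c·1` the stable isotropic lines are all the isotropic lines. [cite: Flicker1998UnitaryFL, §6 p. 97] -/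
theorem ncard_isotropicLines_stable_smul_one_eq [Finite 𝓀] {b : 𝓀} (hb : b ≠ 0) (c : 𝓀) :
    {p : ℙ 𝓀 (Fin 2 → 𝓀) | ∃ (v : Fin 2 → 𝓀) (hv : v ≠ 0), Projectivization.mk 𝓀 v hv = p ∧
        σ (v 0) * b * v 1 + σ (v 1) * σ b * v 0 = 0 ∧ ∃ a : 𝓀, (c • (1 : Matrix (Fin 2) (Fin 2) 𝓀)) *ᵥ v = a • v}.ncard =
      Nat.card {z : 𝓀 // σ z = -z} + 1 := by
  rw [← ncard_isotropicLines_eq σ hb]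
  congr 1
  ext p
  simp only [Set.mem_setOf_eq]
  refine ⟨fun ⟨v, hv, hp, hiso, _⟩ => ⟨v, hv, hp, hiso⟩, fun ⟨v, hv, hp, hiso⟩ => ⟨v, hv, hp, hiso, c, ?_⟩⟩
  rw [Matrix.smul_mulVec, Matrix.one_mulVec]

omit σ in
/-- **A line stable under `c·1 + n` (`n² = 0`, `n ≠ 0`) lies in `ker n`**: if `(c + n) v = a v` then `n v = 0`. [cite: Flicker1998UnitaryFL, §6 p. 97] -/
theorem mulVec_eq_zero_of_stable_transvection {c : 𝓀} {n : Matrix (Fin 2) (Fin 2) 𝓀} (hn2 : n * n = 0) {v : Fin 2 → 𝓀} {a : 𝓀}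
    (h : (c • (1 : Matrix (Fin 2) (Fin 2) 𝓀) + n) *ᵥ v = a • v) : n *ᵥ v = 0 := by
  have hnv : n *ᵥ v = (a - c) • v := by
    rw [Matrix.add_mulVec, Matrix.smul_mulVec, Matrix.one_mulVec] at h
    rw [sub_smul, ← h, add_sub_cancel_left]
  have h0 : (a - c) ^ 2 • v = 0 := by
    rw [pow_two, mul_smul, ← hnv, ← Matrix.mulVec_smul, ← hnv, Matrix.mulVec_mulVec, hn2, Matrix.zero_mulVec]
  by_cases hv : v = 0
  · rw [hv, Matrix.mulVec_zero]
  · have hac : a - c = 0 := by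
      rcases smul_eq_zero.1 h0 with h | h
      · exact pow_eq_zero_iff (n := 2) (by norm_num) |>.1 h
      · exact absurd h hv
    rw [hnv, hac, zero_smul]

omit σ in
/-- **`ker n` is a line** (`n ≠ 0` on `𝓀²`): two kernel vectors with the first non-zero are proportional. [cite: Flicker1998UnitaryFL, §6 p. 97] -/
theorem exists_smul_eq_of_mulVec_eq_zero {n : Matrix (Fin 2) (Fin 2) 𝓀} (hn : n ≠ 0) {v₀ v : Fin 2 → 𝓀} (hv₀ : v₀ ≠ 0)
    (h₀ : n *ᵥ v₀ = 0) (h : n *ᵥ v = 0) : ∃ a : 𝓀, a • v₀ = v := by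
  -- the matrix `M` with columns `v₀, v` satisfies `n · M = 0`; if `det M ≠ 0` then `n = 0`
  by_cases hd : v₀ 0 * v 1 - v₀ 1 * v 0 = 0
  · by_cases h00 : v₀ 0 = 0
    · have h01 : v₀ 1 ≠ 0 := fun h1 => hv₀ (by ext i; fin_cases i <;> simp [h00, h1])
      have hv0 : v 0 = 0 := by
        rw [h00, zero_mul, zero_sub, neg_eq_zero] at hd
        exact (mul_eq_zero.1 hd).resolve_left h01
      refine ⟨v 1 * (v₀ 1)⁻¹, ?_⟩
      ext i; fin_cases i
      · simp [h00, hv0]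
      · simp [inv_mul_cancel_right₀ h01]
    · refine ⟨v 0 * (v₀ 0)⁻¹, ?_⟩
      have h1 : v 0 * (v₀ 0)⁻¹ * v₀ 1 = v 1 := by
        rw [mul_assoc, mul_comm ((v₀ 0)⁻¹), ← mul_assoc, ← div_eq_mul_inv, div_eq_iff h00]
        linear_combination (-1 : 𝓀) * hd
      ext i; fin_cases i
      · simp [inv_mul_cancel_right₀ h00]
      · simpa using h1
  · exfalso
    apply hn
    have hM : n * !![v₀ 0, v 0; v₀ 1, v 1] = 0 := by
      have e0 := congrFun h₀; have e1 := congrFun h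
      simp only [Matrix.mulVec, dotProduct, Fin.sum_univ_two, Pi.zero_apply] at e0 e1
      ext i j
      fin_cases i <;> fin_cases j <;> simp [Matrix.mul_apply, Fin.sum_univ_two, e0, e1]
    have hdet : IsUnit (Matrix.det (!![v₀ 0, v 0; v₀ 1, v 1] : Matrix (Fin 2) (Fin 2) 𝓀)) := by
      rw [Matrix.det_fin_two_of, isUnit_iff_ne_zero]
      intro h'; exact hd (by linear_combination h')
    calc n = n * !![v₀ 0, v 0; v₀ 1, v 1] * (!![v₀ 0, v 0; v₀ 1, v 1])⁻¹ := (Matrix.mul_nonsing_inv_cancel_right _ _ hdet).symm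
      _ = 0 := by rw [hM, Matrix.zero_mul]

/-- **A TRANSVECTION FIXES EXACTLY ONE LINE, ITS KERNEL; IF THAT LINE IS ISOTROPIC THE STABLE ISOTROPIC LINES NUMBER ONE**: for `γ̄ = c·1 + n`, `n ≠ 0`, `n² = 0`, and
`v₀ ≠ 0` with `n v₀ = 0`, `⟨v₀, v₀⟩ = 0`: `#{ℓ isotropic | γ̄ℓ = ℓ} = 1` (the boundary vertices of a fixed ball in the tree keep only the inward edge).
[cite: Flicker1998UnitaryFL, §6 p. 97] [cite: Rogawski1990, §12.6 p. 174] -/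
theorem ncard_isotropicLines_stable_transvection_eq_one {b : 𝓀} (c : 𝓀) {n : Matrix (Fin 2) (Fin 2) 𝓀} (hn : n ≠ 0) (hn2 : n * n = 0)
    {v₀ : Fin 2 → 𝓀} (hv₀ : v₀ ≠ 0) (hnv₀ : n *ᵥ v₀ = 0) (hiso₀ : σ (v₀ 0) * b * v₀ 1 + σ (v₀ 1) * σ b * v₀ 0 = 0) :
    {p : ℙ 𝓀 (Fin 2 → 𝓀) | ∃ (v : Fin 2 → 𝓀) (hv : v ≠ 0), Projectivization.mk 𝓀 v hv = p ∧
        σ (v 0) * b * v 1 + σ (v 1) * σ b * v 0 = 0 ∧ ∃ a : 𝓀, (c • (1 : Matrix (Fin 2) (Fin 2) 𝓀) + n) *ᵥ v = a • v}.ncard = 1 := by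
  rw [Set.ncard_eq_one]
  refine ⟨Projectivization.mk 𝓀 v₀ hv₀, Set.eq_singleton_iff_unique_mem.2 ⟨?_, ?_⟩⟩
  · refine ⟨v₀, hv₀, rfl, hiso₀, c, ?_⟩
    rw [Matrix.add_mulVec, Matrix.smul_mulVec, Matrix.one_mulVec, hnv₀, add_zero]
  · rintro p ⟨v, hv, rfl, -, a, ha⟩
    obtain ⟨t, ht⟩ := exists_smul_eq_of_mulVec_eq_zero hn hv₀ hnv₀ (mulVec_eq_zero_of_stable_transvection hn2 ha)
    exact (mk_eq_mk_iff' 𝓀 v v₀ hv hv₀).2 ⟨t, ht⟩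

/-! ## §3 (ED. 2, append-only) A unitary transvection has isotropic kernel; the type-(2) dichotomy `(2m − t)² = (t² − 4d)·1` -/

/-- **THE KERNEL OF A UNITARY TRANSVECTION IS ISOTROPIC** (`σ² = 1`): if `u = c·1 + n` (`n ≠ 0`, `n² = 0`) preserves the form `⟨v, w⟩ = σ(v₀)·b·w₁ + σ(v₁)·σb·w₀`, then every
`v₀ ∈ ker n` is isotropic — otherwise `σ(c)c = 1` on `v₀` and polarising against `v₀` forces `n = 0`.  (In the tree: the one edge kept by a boundary vertex points inward.)
[cite: Flicker1998UnitaryFL, §6 p. 97] [cite: Rogawski1990, §12.6 p. 174] -/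
theorem form_eq_zero_of_unitary_transvection (hσσ : ∀ x, σ (σ x) = x) {b : 𝓀} (c : 𝓀) {n : Matrix (Fin 2) (Fin 2) 𝓀} (hn : n ≠ 0)
    (hn2 : n * n = 0)
    (hu : ∀ v w : Fin 2 → 𝓀,
      σ (((c • (1 : Matrix (Fin 2) (Fin 2) 𝓀) + n) *ᵥ v) 0) * b * ((c • (1 : Matrix (Fin 2) (Fin 2) 𝓀) + n) *ᵥ w) 1 +
          σ (((c • (1 : Matrix (Fin 2) (Fin 2) 𝓀) + n) *ᵥ v) 1) * σ b * ((c • (1 : Matrix (Fin 2) (Fin 2) 𝓀) + n) *ᵥ w) 0 =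
        σ (v 0) * b * w 1 + σ (v 1) * σ b * w 0)
    {v₀ : Fin 2 → 𝓀} (hv₀ : v₀ ≠ 0) (hnv₀ : n *ᵥ v₀ = 0) :
    σ (v₀ 0) * b * v₀ 1 + σ (v₀ 1) * σ b * v₀ 0 = 0 := by
  by_contra hne
  have huv₀ : (c • (1 : Matrix (Fin 2) (Fin 2) 𝓀) + n) *ᵥ v₀ = c • v₀ := by
    rw [Matrix.add_mulVec, Matrix.smul_mulVec, Matrix.one_mulVec, hnv₀, add_zero]
  -- `σ(c)·c = 1` from `⟨u v₀, u v₀⟩ = ⟨v₀, v₀⟩`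
  have hcc : σ c * c = 1 := by
    have h := hu v₀ v₀
    rw [huv₀, form_smul_smul] at h
    exact mul_right_cancel₀ hne (by rw [h, one_mul])
  have hc0 : c ≠ 0 := fun h => by rw [h, mul_zero] at hcc; exact zero_ne_one hcc
  -- every `n v` is a multiple `λ v₀` with `σ(λ)·c·⟨v₀,v₀⟩ = 0`, hence `λ = 0`
  have hnv : ∀ v, n *ᵥ v = 0 := fun v => by
    obtain ⟨l, hl⟩ := exists_smul_eq_of_mulVec_eq_zero hn hv₀ hnv₀
      (show n *ᵥ (n *ᵥ v) = 0 by rw [Matrix.mulVec_mulVec, hn2, Matrix.zero_mulVec])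
    have huv : (c • (1 : Matrix (Fin 2) (Fin 2) 𝓀) + n) *ᵥ v = c • v + l • v₀ := by
      rw [Matrix.add_mulVec, Matrix.smul_mulVec, Matrix.one_mulVec, hl]
    have h := hu v v₀
    rw [huv₀, huv] at h
    simp only [Pi.add_apply, Pi.smul_apply, smul_eq_mul, map_add, map_mul] at h
    -- `h : ⟨c v + l v₀, c v₀⟩ = ⟨v, v₀⟩`; expand and use `σ(c) c = 1`
    have key : σ l * c * (σ (v₀ 0) * b * v₀ 1 + σ (v₀ 1) * σ b * v₀ 0) = 0 := by
      have e : (σ c * σ (v 0) + σ l * σ (v₀ 0)) * b * (c * v₀ 1) + (σ c * σ (v 1) + σ l * σ (v₀ 1)) * σ b * (c * v₀ 0)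
          = σ c * c * (σ (v 0) * b * v₀ 1 + σ (v 1) * σ b * v₀ 0) + σ l * c * (σ (v₀ 0) * b * v₀ 1 + σ (v₀ 1) * σ b * v₀ 0) := by ring
      rw [e, hcc, one_mul, add_eq_left] at h
      exact h
    have hl0 : l = 0 := by
      rcases mul_eq_zero.1 key with h1 | h1
      · rcases mul_eq_zero.1 h1 with h2 | h2
        · simpa [hσσ] using congrArg σ h2
        · exact absurd h2 hc0
      · exact absurd h1 hne
    rw [← hl, hl0, zero_smul]
  exact hn (by ext i j; simpa [Matrix.mulVec, dotProduct, Pi.single_apply, Fin.sum_univ_two] using congrFun (hnv (Pi.single j 1)) i)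

/-- **A UNITARY TRANSVECTION FIXES EXACTLY ONE ISOTROPIC LINE** (`σ² = 1`, `b ≠ 0`; no kernel data needed): `#{ℓ isotropic | (c·1 + n)ℓ = ℓ} = 1` for `n ≠ 0`, `n² = 0`,
`c·1 + n` unitary. [cite: Flicker1998UnitaryFL, §6 p. 97] [cite: Rogawski1990, §12.6 p. 174] -/
theorem ncard_isotropicLines_stable_unitary_transvection_eq_one (hσσ : ∀ x, σ (σ x) = x) {b : 𝓀} (c : 𝓀) {n : Matrix (Fin 2) (Fin 2) 𝓀}
    (hn : n ≠ 0) (hn2 : n * n = 0)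
    (hu : ∀ v w : Fin 2 → 𝓀,
      σ (((c • (1 : Matrix (Fin 2) (Fin 2) 𝓀) + n) *ᵥ v) 0) * b * ((c • (1 : Matrix (Fin 2) (Fin 2) 𝓀) + n) *ᵥ w) 1 +
          σ (((c • (1 : Matrix (Fin 2) (Fin 2) 𝓀) + n) *ᵥ v) 1) * σ b * ((c • (1 : Matrix (Fin 2) (Fin 2) 𝓀) + n) *ᵥ w) 0 =
        σ (v 0) * b * w 1 + σ (v 1) * σ b * w 0) :
    {p : ℙ 𝓀 (Fin 2 → 𝓀) | ∃ (v : Fin 2 → 𝓀) (hv : v ≠ 0), Projectivization.mk 𝓀 v hv = p ∧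
        σ (v 0) * b * v 1 + σ (v 1) * σ b * v 0 = 0 ∧ ∃ a : 𝓀, (c • (1 : Matrix (Fin 2) (Fin 2) 𝓀) + n) *ᵥ v = a • v}.ncard = 1 := by
  -- a non-zero kernel vector: some column `n eⱼ ≠ 0`, and `n (n eⱼ) = 0`
  obtain ⟨j, hj⟩ : ∃ j : Fin 2, n *ᵥ (Pi.single j 1) ≠ 0 := by
    by_contra h
    simp only [ne_eq, not_exists, not_not] at h
    exact hn (by ext i j; simpa [Matrix.mulVec, dotProduct, Pi.single_apply, Fin.sum_univ_two] using congrFun (h j) i)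
  have hk : n *ᵥ (n *ᵥ (Pi.single j 1)) = 0 := by rw [Matrix.mulVec_mulVec, hn2, Matrix.zero_mulVec]
  exact ncard_isotropicLines_stable_transvection_eq_one σ c hn hn2 hj hk (form_eq_zero_of_unitary_transvection σ hσσ c hn hn2 hu hj hk)

omit σ in
/-- **THE TYPE-(2) DICHOTOMY AT A FIXED VERTEX**: for any `2×2` matrix `m` over a commutative ring, `(2m − (tr m)·1)² = ((tr m)² − 4 det m)·1` (Cayley–Hamilton); so when
`ϖ ∣ (tr m)² − 4 det m` (ramified splitting field) the reduction of `m` on every stable lattice is a scalar plus a square-zero nilpotent — scalar or a transvection.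
[cite: Flicker1998UnitaryFL, §6 p. 97] [cite: Rogawski1990, §12.6 p. 174] -/
theorem two_smul_sub_trace_smul_one_sq {R : Type*} [CommRing R] (m : Matrix (Fin 2) (Fin 2) R) :
    ((2 : R) • m - m.trace • (1 : Matrix (Fin 2) (Fin 2) R)) * ((2 : R) • m - m.trace • (1 : Matrix (Fin 2) (Fin 2) R)) =
      (m.trace ^ 2 - 4 * m.det) • (1 : Matrix (Fin 2) (Fin 2) R) := by
  rw [Matrix.trace_fin_two, Matrix.det_fin_two]
  ext i j
  fin_cases i <;> fin_cases j <;> simp [Matrix.mul_apply, Fin.sum_univ_two, Matrix.one_apply] <;> ring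

end Literature.LinearAlgebra.HermitianPlane

end
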